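import Mathlib
import HarnessLib
import Summits.HubbardSuperconductivity.HubbardSuperconductivity.Theorems.KLProgrammeC4aAbsBubbleAngleLayer
import Summits.HubbardSuperconductivity.HubbardSuperconductivity.Theorems.KLProgrammeC4aLoopNondegeneracyPh

/-!
# Route `KLProgramme` — crux C4a, S3 brick (B4)/(B5) «(B4)-DIRECT-PACK», part 7: the PARTICLE–HOLE twin of the tube-angle layer, the shift to any
# angular window, and the LARGE-LEVEL layer (levels above an `n`-free floor cost `1/h₁`)

Cell `gate-hubbard-kl`, seat hubbard-kl-k3c3-p3 (g27; row «implicit-function / monotonicity route for μ(n)»).  Located brick for the (C)-closer lane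
hubbard-kl-c4a-1 (stub (C) `stub_twoLeg_curvature` of `KLRegimeEngineV17F2`, stmt-HubbardSuperconductivity-20437), memo B4-DIRECT-PACK.md §4/§6.

* §1 **ph = pp at `ϑ − π`** (g19 `pairDiffPath_eq_pairSumPath_sub_pi`, `e_K` even): the ph partner band `e_K(Φ(e,x+θ) − D_{ρϑθ})` IS the pp partner band of the
  configuration `(ρ, ϑ − π, θ)` (`partnerBand_ph_eq_pp_sub_pi`); the pp family is `2π`-periodic in `ϑ` (`partnerBand_pp_add_two_pi`).
* §2 **`intervalIntegral_angle_absBubble_partnerBand_le_window`**: part 6's bound on ANY window `[c − π, c + π]` (periodicity), and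
  **`intervalIntegral_angle_absBubble_partnerBand_ph_le`**: the ph twin on `[0 − π, 0 + π]` (the forward configuration `ϑ = 0` is the ph Cooper point) — same
  constant, uniformly in `(ρ, θ)`.
* §3 **`level_loop_le_large_levels`** (any level family): levels `e ∈ [h₁, hi]` above a floor `h₁ > 0` cost `W·((b−a)/h₁)·(hi − h₁)` by the trivial bound — the
  smallness conditions of parts 3/5/6 may force a small `hi`; the levels above it are `n`-free for free as long as the split point `h₁` is `n`-free.
Nothing asserts (C), K3 or superconductivity.  References: Salmhofer 1999 §4.5.3 Cor. 4.11 [cite: Salmhofer1999]; FST II CPAM 51 (1998) §3 [cite: FeldmanSalmhoferTrubowitz1998].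
-/

noncomputable section

namespace Summit.HubbardSuperconductivity.HubbardSuperconductivity.Theorems.C4a

set_option linter.dupNamespace false -- summit = problem name (single-conjunct summit), D-0017

open Real Set MeasureTheory
open Literature.MathematicalPhysics.QuantumLattice Literature.MathematicalPhysics.QuantumLattice.BandSectorCounting
open Literature.MathematicalPhysics.QuantumLattice.FermiRG
open Summit.HubbardSuperconductivity.HubbardSuperconductivity.Theorems.KLRegimeSplit
open Summit.HubbardSuperconductivity.HubbardSuperconductivity.Theorems.DispersionFlow
open Summit.HubbardSuperconductivity.HubbardSuperconductivity.Theorems.PerturbedFermiCurve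

/-! ## §1 ph = pp at `ϑ − π`; periodicity in the tube angle -/

/-- **The ph partner band is the pp partner band at `ϑ − π`**: `e_K(Φ(e,x+θ) − D_{ρϑθ}(0)) = e_K(S_{ρ,ϑ−π,θ}(0) − Φ(e,x+θ))`. -/
theorem partnerBand_ph_eq_pp_sub_pi (μ : ℝ) (K : TrigPolyC4v) (ρ ϑ θ e x : ℝ) :
    frameLevel μ K (levelPoint μ K e (x + θ) - pairDiffPath μ K ρ ϑ θ 0) =
      frameLevel μ K (pairSumPath μ K ρ (ϑ - π) θ 0 - levelPoint μ K e (x + θ)) := by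
  rw [← frameLevel_neg μ K (levelPoint μ K e (x + θ) - pairDiffPath μ K ρ ϑ θ 0), neg_sub, pairDiffPath_eq_pairSumPath_sub_pi]

/-- The pp pair sum is `2π`-periodic in the tube angle. -/
theorem pairSumPath_add_two_pi (μ : ℝ) (K : TrigPolyC4v) (ρ ϑ θ : ℝ) :
    pairSumPath μ K ρ (ϑ + 2 * π) θ 0 = pairSumPath μ K ρ ϑ θ 0 := by
  simp only [pairSumPath, add_zero]
  rw [show ϑ + 2 * π + θ = (ϑ + θ) + 2 * π by ring, levelPoint_add_two_pi]

/-! ## §3 The large-level layer (any level family) -/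

/-- **LEVELS ABOVE A FLOOR ARE FREE**: for any level family `G`, levels `e ∈ [h₁, hi]` with `0 < h₁`, envelope floors `t e ≥ e` and weight `0 ≤ w ≤ W`:
`∫_{h₁..hi} w(e)·(∫_{[a,b]} dx/max(t e,|G e x|)) de ≤ W·((b−a)/h₁)·(hi − h₁)` (the trivial bound `(b−a)/t ≤ (b−a)/h₁`). -/
theorem level_loop_le_large_levels {a b h₁ hi W : ℝ} {G : ℝ → ℝ → ℝ} {t wt : ℝ → ℝ} (hab : a ≤ b) (hh₁ : 0 < h₁) (hhhi : h₁ ≤ hi)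
    (ht : ∀ e ∈ Icc h₁ hi, e ≤ t e) (hW : 0 ≤ W) (hw0 : ∀ e ∈ Icc h₁ hi, 0 ≤ wt e) (hw : ∀ e ∈ Icc h₁ hi, wt e ≤ W) :
    ∫ e in h₁..hi, wt e * ∫ x in Icc a b, (max (t e) |G e x|)⁻¹ ≤ W * ((b - a) / h₁ * (hi - h₁)) := by
  have hte : ∀ e ∈ Icc h₁ hi, 0 < t e := fun e he => (hh₁.trans_le he.1).trans_le (ht e he)
  have h := intervalIntegral_level_layer_le hh₁ hhhi (w := wt) (I := fun e => ∫ x in Icc a b, (max (t e) |G e x|)⁻¹) (A := (b - a) / h₁)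
    (B := 0) (C := 0) (κ := 1) hW (div_nonneg (by linarith) hh₁.le) le_rfl le_rfl hw0 hw
    (fun e he => integral_inv_envelope_nonneg (G e) (hte e he) a b) fun e he => by
      have h1 := integral_inv_envelope_le_trivial hab (G e) (hte e he)
      have h2 : (b - a) / t e ≤ (b - a) / h₁ := div_le_div_of_nonneg_left (by linarith) hh₁ ((he.1).trans (ht e he))
      simpa using h1.trans h2
  simpa using h

section Sizes

variable {K : TrigPolyC4v} {A : ℝ} (hA : ∀ p : Momentum, ∀ j ≤ 2, ‖iteratedFDeriv ℝ j (frameShift K) p‖ ≤ A) (hA20 : A ≤ 1 / 20)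
  (hd : klCurveD ≤ (bandBounds (show (-4 : ℝ) < -1.1 by norm_num) (show (-1.1 : ℝ) ≤ -0.1 by norm_num)
    (show (-0.1 : ℝ) < 0 by norm_num)).Dtmin - 2 * A)
  {μ r : ℝ} (hr : 0 < r) (hlo : (-1.1 : ℝ) < μ - r - A) (hhi : μ + r + A < -0.1)
  {A₃ A₄ : ℝ} (hA₃ : ∀ p : Momentum, ‖iteratedFDeriv ℝ 3 (frameShift K) p‖ ≤ A₃)
  (hA₄ : ∀ p : Momentum, ‖iteratedFDeriv ℝ 4 (frameShift K) p‖ ≤ A₄)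
  {K₁ K₂ K₃ : ℝ} (hK₁ : ∀ p : Momentum, ‖fderiv ℝ (frameLevel μ K) p‖ ≤ K₁) (hK₂ : ∀ p : Momentum, ‖iteratedFDeriv ℝ 2 (frameLevel μ K) p‖ ≤ K₂)
  (hK₃ : ∀ p : Momentum, ‖iteratedFDeriv ℝ 3 (frameLevel μ K) p‖ ≤ K₃)
include hA hA20 hd hr hlo hhi hA₃ hA₄ hK₁ hK₂ hK₃

/-! ## §2 Any angular window; the ph twin -/

/-- **Part 6 on ANY window `[c − π, c + π]`** (the pp family is `2π`-periodic in `ϑ`). -/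
theorem intervalIntegral_angle_absBubble_partnerBand_le_window {Kc r₀ g₀ w : ℝ} (hG : GeomConstants (frameLevel μ K) Kc r₀ g₀ w) (hK₁0 : 0 < K₁) (hK₂0 : 0 < K₂)
    {ρ θ a b lo hi W c₀ c₁ sC d₁ κ : ℝ} {t wt : ℝ → ℝ} {NC NT : ℕ} (c : ℝ) (hρ : |ρ| < r)
    (hab : a ≤ b) (hlo0 : 0 < lo) (hlohi : lo ≤ hi) (hhir₀ : hi < r₀)
    (hc₀ : 0 < c₀) (hc₁ : 0 < c₁)
    (hX : ((msD A₃ A₄ 1 *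
            ((π / 2 * c₁ /
                  (((bandBounds (show (-4 : ℝ) < -1.1 by norm_num) (show (-1.1 : ℝ) ≤ -0.1 by norm_num) (show (-0.1 : ℝ) < 0 by norm_num)).Dtmin -
                      2 * A) *
                    (bandBounds (show (-4 : ℝ) < -1.1 by norm_num) (show (-1.1 : ℝ) ≤ -0.1 by norm_num) (show (-0.1 : ℝ) < 0 by norm_num)).umin) +
                π * Kc * c₀ / ((bandBounds (show (-4 : ℝ) < -1.1 by norm_num) (show (-1.1 : ℝ) ≤ -0.1 by norm_num) (show (-0.1 : ℝ) < 0 by norm_num)).Dtmin - 2 * A) ^ 2) /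
              ((bandBounds (show (-4 : ℝ) < -1.1 by norm_num) (show (-1.1 : ℝ) ≤ -0.1 by norm_num) (show (-0.1 : ℝ) < 0 by norm_num)).umin * w /
                (4 + 2 * A)))) +
          c₀ / ((bandBounds (show (-4 : ℝ) < -1.1 by norm_num) (show (-1.1 : ℝ) ≤ -0.1 by norm_num) (show (-0.1 : ℝ) < 0 by norm_num)).Dtmin - 2 * A)) < 1)
    (hwinC : sC * ((msD A₃ A₄ 1 *
            ((π / 2 * c₁ /
                  (((bandBounds (show (-4 : ℝ) < -1.1 by norm_num) (show (-1.1 : ℝ) ≤ -0.1 by norm_num) (show (-0.1 : ℝ) < 0 by norm_num)).Dtmin -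
                      2 * A) *
                    (bandBounds (show (-4 : ℝ) < -1.1 by norm_num) (show (-1.1 : ℝ) ≤ -0.1 by norm_num) (show (-0.1 : ℝ) < 0 by norm_num)).umin) +
                π * Kc * c₀ / ((bandBounds (show (-4 : ℝ) < -1.1 by norm_num) (show (-1.1 : ℝ) ≤ -0.1 by norm_num) (show (-0.1 : ℝ) < 0 by norm_num)).Dtmin - 2 * A) ^ 2) /
              ((bandBounds (show (-4 : ℝ) < -1.1 by norm_num) (show (-1.1 : ℝ) ≤ -0.1 by norm_num) (show (-0.1 : ℝ) < 0 by norm_num)).umin * w /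
                (4 + 2 * A)))) +
          c₀ / ((bandBounds (show (-4 : ℝ) < -1.1 by norm_num) (show (-1.1 : ℝ) ≤ -0.1 by norm_num) (show (-0.1 : ℝ) < 0 by norm_num)).Dtmin - 2 * A)) +
          2 * hi / ((bandBounds (show (-4 : ℝ) < -1.1 by norm_num) (show (-1.1 : ℝ) ≤ -0.1 by norm_num) (show (-0.1 : ℝ) < 0 by norm_num)).Dtmin - 2 * A) + sC < 3 / 5)
    (hwinC' : sC * ((msD A₃ A₄ 1 *
            ((π / 2 * c₁ /
                  (((bandBounds (show (-4 : ℝ) < -1.1 by norm_num) (show (-1.1 : ℝ) ≤ -0.1 by norm_num) (show (-0.1 : ℝ) < 0 by norm_num)).Dtmin -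
                      2 * A) *
                    (bandBounds (show (-4 : ℝ) < -1.1 by norm_num) (show (-1.1 : ℝ) ≤ -0.1 by norm_num) (show (-0.1 : ℝ) < 0 by norm_num)).umin) +
                π * Kc * c₀ / ((bandBounds (show (-4 : ℝ) < -1.1 by norm_num) (show (-1.1 : ℝ) ≤ -0.1 by norm_num) (show (-0.1 : ℝ) < 0 by norm_num)).Dtmin - 2 * A) ^ 2) /
              ((bandBounds (show (-4 : ℝ) < -1.1 by norm_num) (show (-1.1 : ℝ) ≤ -0.1 by norm_num) (show (-0.1 : ℝ) < 0 by norm_num)).umin * w /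
                (4 + 2 * A)))) +
          c₀ / ((bandBounds (show (-4 : ℝ) < -1.1 by norm_num) (show (-1.1 : ℝ) ≤ -0.1 by norm_num) (show (-0.1 : ℝ) < 0 by norm_num)).Dtmin - 2 * A)) +
          2 * hi / ((bandBounds (show (-4 : ℝ) < -1.1 by norm_num) (show (-1.1 : ℝ) ≤ -0.1 by norm_num) (show (-0.1 : ℝ) < 0 by norm_num)).Dtmin - 2 * A) + sC <
        2 * (bandBounds (show (-4 : ℝ) < -1.1 by norm_num) (show (-1.1 : ℝ) ≤ -0.1 by norm_num) (show (-0.1 : ℝ) < 0 by norm_num)).umin)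
    (hhirC : hi + c₀ * sC < r) (hNC : (b - a) * (4 * (K₂ * msD A₃ A₄ 1)) ≤ NC * c₀)
    (hd₁ : 0 < d₁) (hκ : 0 < κ)
    (hs₀ : ((msD A₃ A₄ 1 *
            ((π / 2 * d₁ /
                  (((bandBounds (show (-4 : ℝ) < -1.1 by norm_num) (show (-1.1 : ℝ) ≤ -0.1 by norm_num) (show (-0.1 : ℝ) < 0 by norm_num)).Dtmin -
                      2 * A) *
                    (bandBounds (show (-4 : ℝ) < -1.1 by norm_num) (show (-1.1 : ℝ) ≤ -0.1 by norm_num) (show (-0.1 : ℝ) < 0 by norm_num)).umin) +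
                π * Kc * κ / ((bandBounds (show (-4 : ℝ) < -1.1 by norm_num) (show (-1.1 : ℝ) ≤ -0.1 by norm_num) (show (-0.1 : ℝ) < 0 by norm_num)).Dtmin - 2 * A) ^ 2) /
              ((bandBounds (show (-4 : ℝ) < -1.1 by norm_num) (show (-1.1 : ℝ) ≤ -0.1 by norm_num) (show (-0.1 : ℝ) < 0 by norm_num)).umin * w /
                (4 + 2 * A)))) +
          κ / ((bandBounds (show (-4 : ℝ) < -1.1 by norm_num) (show (-1.1 : ℝ) ≤ -0.1 by norm_num) (show (-0.1 : ℝ) < 0 by norm_num)).Dtmin - 2 * A)) ≤ sC)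
    (hs₀' : ((msD A₃ A₄ 1 *
            ((π / 2 * d₁ /
                  (((bandBounds (show (-4 : ℝ) < -1.1 by norm_num) (show (-1.1 : ℝ) ≤ -0.1 by norm_num) (show (-0.1 : ℝ) < 0 by norm_num)).Dtmin -
                      2 * A) *
                    (bandBounds (show (-4 : ℝ) < -1.1 by norm_num) (show (-1.1 : ℝ) ≤ -0.1 by norm_num) (show (-0.1 : ℝ) < 0 by norm_num)).umin) +
                π * Kc * κ / ((bandBounds (show (-4 : ℝ) < -1.1 by norm_num) (show (-1.1 : ℝ) ≤ -0.1 by norm_num) (show (-0.1 : ℝ) < 0 by norm_num)).Dtmin - 2 * A) ^ 2) /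
              ((bandBounds (show (-4 : ℝ) < -1.1 by norm_num) (show (-1.1 : ℝ) ≤ -0.1 by norm_num) (show (-0.1 : ℝ) < 0 by norm_num)).umin * w /
                (4 + 2 * A)))) +
          κ / ((bandBounds (show (-4 : ℝ) < -1.1 by norm_num) (show (-1.1 : ℝ) ≤ -0.1 by norm_num) (show (-0.1 : ℝ) < 0 by norm_num)).Dtmin - 2 * A)) ≤ 3 / 5)
    (hhirT : hi + κ < r)
    (hsmall :
        K₃ * ((msD A₃ A₄ 1 *
            ((π / 2 * d₁ /
                  (((bandBounds (show (-4 : ℝ) < -1.1 by norm_num) (show (-1.1 : ℝ) ≤ -0.1 by norm_num) (show (-0.1 : ℝ) < 0 by norm_num)).Dtmin -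
                      2 * A) *
                    (bandBounds (show (-4 : ℝ) < -1.1 by norm_num) (show (-1.1 : ℝ) ≤ -0.1 by norm_num) (show (-0.1 : ℝ) < 0 by norm_num)).umin) +
                π * Kc * κ / ((bandBounds (show (-4 : ℝ) < -1.1 by norm_num) (show (-1.1 : ℝ) ≤ -0.1 by norm_num) (show (-0.1 : ℝ) < 0 by norm_num)).Dtmin - 2 * A) ^ 2) /
              ((bandBounds (show (-4 : ℝ) < -1.1 by norm_num) (show (-1.1 : ℝ) ≤ -0.1 by norm_num) (show (-0.1 : ℝ) < 0 by norm_num)).umin * w /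
                (4 + 2 * A)))) +
          (2 * hi + κ) / ((bandBounds (show (-4 : ℝ) < -1.1 by norm_num) (show (-1.1 : ℝ) ≤ -0.1 by norm_num) (show (-0.1 : ℝ) < 0 by norm_num)).Dtmin - 2 * A) +
              hi / ((bandBounds (show (-4 : ℝ) < -1.1 by norm_num) (show (-1.1 : ℝ) ≤ -0.1 by norm_num) (show (-0.1 : ℝ) < 0 by norm_num)).Dtmin - 2 * A)) *
            msD A₃ A₄ 1 ^ 2 +
          K₂ * (radialRowOneConst A ((bandBounds (show (-4 : ℝ) < -1.1 by norm_num) (show (-1.1 : ℝ) ≤ -0.1 by norm_num) (show (-0.1 : ℝ) < 0 by norm_num)).Dtmin -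
                2 * A) * hi) * (msD A₃ A₄ 1 + msD A₃ A₄ 1) +
          K₂ * ((msD A₃ A₄ 1 *
            ((π / 2 * d₁ /
                  (((bandBounds (show (-4 : ℝ) < -1.1 by norm_num) (show (-1.1 : ℝ) ≤ -0.1 by norm_num) (show (-0.1 : ℝ) < 0 by norm_num)).Dtmin -
                      2 * A) *
                    (bandBounds (show (-4 : ℝ) < -1.1 by norm_num) (show (-1.1 : ℝ) ≤ -0.1 by norm_num) (show (-0.1 : ℝ) < 0 by norm_num)).umin) +
                π * Kc * κ / ((bandBounds (show (-4 : ℝ) < -1.1 by norm_num) (show (-1.1 : ℝ) ≤ -0.1 by norm_num) (show (-0.1 : ℝ) < 0 by norm_num)).Dtmin - 2 * A) ^ 2) /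
              ((bandBounds (show (-4 : ℝ) < -1.1 by norm_num) (show (-1.1 : ℝ) ≤ -0.1 by norm_num) (show (-0.1 : ℝ) < 0 by norm_num)).umin * w /
                (4 + 2 * A)))) +
          (2 * hi + κ) / ((bandBounds (show (-4 : ℝ) < -1.1 by norm_num) (show (-1.1 : ℝ) ≤ -0.1 by norm_num) (show (-0.1 : ℝ) < 0 by norm_num)).Dtmin - 2 * A) +
              hi / ((bandBounds (show (-4 : ℝ) < -1.1 by norm_num) (show (-1.1 : ℝ) ≤ -0.1 by norm_num) (show (-0.1 : ℝ) < 0 by norm_num)).Dtmin - 2 * A)) *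
            msD A₃ A₄ 2 +
          K₁ * ((uRowTwoConst A A₃ ((bandBounds (show (-4 : ℝ) < -1.1 by norm_num) (show (-1.1 : ℝ) ≤ -0.1 by norm_num) (show (-0.1 : ℝ) < 0 by norm_num)).Dtmin -
                  2 * A) +
                1 / ((bandBounds (show (-4 : ℝ) < -1.1 by norm_num) (show (-1.1 : ℝ) ≤ -0.1 by norm_num) (show (-0.1 : ℝ) < 0 by norm_num)).Dtmin - 2 * A) +
                2 * (radialRowOneConst A ((bandBounds (show (-4 : ℝ) < -1.1 by norm_num) (show (-1.1 : ℝ) ≤ -0.1 by norm_num) (show (-0.1 : ℝ) < 0 by norm_num)).Dtmin - 2 * A) -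
                  1 / ((bandBounds (show (-4 : ℝ) < -1.1 by norm_num) (show (-1.1 : ℝ) ≤ -0.1 by norm_num) (show (-0.1 : ℝ) < 0 by norm_num)).Dtmin - 2 * A))) *
              hi) ≤
        w * (bandBounds (show (-4 : ℝ) < -1.1 by norm_num) (show (-1.1 : ℝ) ≤ -0.1 by norm_num) (show (-0.1 : ℝ) < 0 by norm_num)).umin ^ 2)
    (hNT : (b - a) * (4 * (K₁ * msD A₃ A₄ 1)) ≤ NT * κ) (hNT' : (b - a) * (4 * (K₂ * msD A₃ A₄ 1 ^ 2 + K₁ * msD A₃ A₄ 2)) ≤ NT * d₁)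
    (ht : ∀ e ∈ Icc lo hi, e ≤ t e) (hW : 0 ≤ W) (hw0 : ∀ e ∈ Icc lo hi, 0 ≤ wt e) (hw : ∀ e ∈ Icc lo hi, wt e ≤ W) :
    ∫ ϑ in (c - π)..(c + π), (∫ e in lo..hi, wt e * ∫ x in Icc a b, (max (t e) |frameLevel μ K (pairSumPath μ K ρ ϑ θ 0 - levelPoint μ K e (x + θ))|)⁻¹) ≤
      2 * π * ((W * ((4 * (b - a) / κ + 2 * (NT * (4 / d₁))) * (κ / 2) +
          2 * (12 * NT / Real.sqrt (w * (bandBounds (show (-4 : ℝ) < -1.1 by norm_num) (show (-1.1 : ℝ) ≤ -0.1 by norm_num) (show (-0.1 : ℝ) < 0 by norm_num)).umin ^ 2)) * Real.sqrt (κ / 2) + (b - a) * log⁺ (hi / (κ / 2)))) + (W * (2 * (b - a) + 2 * (NC * c₀ / c₁))) +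
        (W * (b - a)) * (1 + log⁺ ((π * hi / (c₀ * (bandBounds (show (-4 : ℝ) < -1.1 by norm_num) (show (-1.1 : ℝ) ≤ -0.1 by norm_num) (show (-0.1 : ℝ) < 0 by norm_num)).umin)) / π))) := by
  have hper : Function.Periodic (fun ϑ => ∫ e in lo..hi, wt e * ∫ x in Icc a b,
      (max (t e) |frameLevel μ K (pairSumPath μ K ρ ϑ θ 0 - levelPoint μ K e (x + θ))|)⁻¹) (2 * π) := fun ϑ => by
    simp only [pairSumPath_add_two_pi]
  have h := intervalIntegral_angle_absBubble_partnerBand_le hA hA20 hd hr hlo hhi hA₃ hA₄ hK₁ hK₂ hK₃ hG hK₁0 hK₂0 (θ := θ) (t := t) (wt := wt) hρ hab hlo0 hlohi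
    hhir₀ hc₀ hc₁ hX hwinC hwinC' hhirC hNC hd₁ hκ hs₀ hs₀' hhirT hsmall hNT hNT' ht hW hw0 hw
  have e1 : ∫ ϑ in (c - π)..(c + π), (∫ e in lo..hi, wt e * ∫ x in Icc a b,
      (max (t e) |frameLevel μ K (pairSumPath μ K ρ ϑ θ 0 - levelPoint μ K e (x + θ))|)⁻¹) =
      ∫ ϑ in (π - π)..(π + π), (∫ e in lo..hi, wt e * ∫ x in Icc a b,
      (max (t e) |frameLevel μ K (pairSumPath μ K ρ ϑ θ 0 - levelPoint μ K e (x + θ))|)⁻¹) := by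
    rw [show c + π = c - π + 2 * π by ring, show π + π = π - π + 2 * π by ring]
    exact hper.intervalIntegral_add_eq (c - π) (π - π)
  rw [e1]; exact h

/-- **THE ph TWIN**: the absolute co-moving bubble of the particle–hole partner band `e_K(Φ(e,x+θ) − D_{ρϑθ})` is `n`-free in `L¹(dϑ)` uniformly in `(ρ,θ)`, with
the SAME constant — the forward configuration `ϑ = 0` is its Cooper point (`D = S` at `ϑ − π`). -/
theorem intervalIntegral_angle_absBubble_partnerBand_ph_le {Kc r₀ g₀ w : ℝ} (hG : GeomConstants (frameLevel μ K) Kc r₀ g₀ w) (hK₁0 : 0 < K₁) (hK₂0 : 0 < K₂)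
    {ρ θ a b lo hi W c₀ c₁ sC d₁ κ : ℝ} {t wt : ℝ → ℝ} {NC NT : ℕ} (hρ : |ρ| < r)
    (hab : a ≤ b) (hlo0 : 0 < lo) (hlohi : lo ≤ hi) (hhir₀ : hi < r₀)
    (hc₀ : 0 < c₀) (hc₁ : 0 < c₁)
    (hX : ((msD A₃ A₄ 1 *
            ((π / 2 * c₁ /
                  (((bandBounds (show (-4 : ℝ) < -1.1 by norm_num) (show (-1.1 : ℝ) ≤ -0.1 by norm_num) (show (-0.1 : ℝ) < 0 by norm_num)).Dtmin -
                      2 * A) *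
                    (bandBounds (show (-4 : ℝ) < -1.1 by norm_num) (show (-1.1 : ℝ) ≤ -0.1 by norm_num) (show (-0.1 : ℝ) < 0 by norm_num)).umin) +
                π * Kc * c₀ / ((bandBounds (show (-4 : ℝ) < -1.1 by norm_num) (show (-1.1 : ℝ) ≤ -0.1 by norm_num) (show (-0.1 : ℝ) < 0 by norm_num)).Dtmin - 2 * A) ^ 2) /
              ((bandBounds (show (-4 : ℝ) < -1.1 by norm_num) (show (-1.1 : ℝ) ≤ -0.1 by norm_num) (show (-0.1 : ℝ) < 0 by norm_num)).umin * w /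
                (4 + 2 * A)))) +
          c₀ / ((bandBounds (show (-4 : ℝ) < -1.1 by norm_num) (show (-1.1 : ℝ) ≤ -0.1 by norm_num) (show (-0.1 : ℝ) < 0 by norm_num)).Dtmin - 2 * A)) < 1)
    (hwinC : sC * ((msD A₃ A₄ 1 *
            ((π / 2 * c₁ /
                  (((bandBounds (show (-4 : ℝ) < -1.1 by norm_num) (show (-1.1 : ℝ) ≤ -0.1 by norm_num) (show (-0.1 : ℝ) < 0 by norm_num)).Dtmin -
                      2 * A) *
                    (bandBounds (show (-4 : ℝ) < -1.1 by norm_num) (show (-1.1 : ℝ) ≤ -0.1 by norm_num) (show (-0.1 : ℝ) < 0 by norm_num)).umin) +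
                π * Kc * c₀ / ((bandBounds (show (-4 : ℝ) < -1.1 by norm_num) (show (-1.1 : ℝ) ≤ -0.1 by norm_num) (show (-0.1 : ℝ) < 0 by norm_num)).Dtmin - 2 * A) ^ 2) /
              ((bandBounds (show (-4 : ℝ) < -1.1 by norm_num) (show (-1.1 : ℝ) ≤ -0.1 by norm_num) (show (-0.1 : ℝ) < 0 by norm_num)).umin * w /
                (4 + 2 * A)))) +
          c₀ / ((bandBounds (show (-4 : ℝ) < -1.1 by norm_num) (show (-1.1 : ℝ) ≤ -0.1 by norm_num) (show (-0.1 : ℝ) < 0 by norm_num)).Dtmin - 2 * A)) +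
          2 * hi / ((bandBounds (show (-4 : ℝ) < -1.1 by norm_num) (show (-1.1 : ℝ) ≤ -0.1 by norm_num) (show (-0.1 : ℝ) < 0 by norm_num)).Dtmin - 2 * A) + sC < 3 / 5)
    (hwinC' : sC * ((msD A₃ A₄ 1 *
            ((π / 2 * c₁ /
                  (((bandBounds (show (-4 : ℝ) < -1.1 by norm_num) (show (-1.1 : ℝ) ≤ -0.1 by norm_num) (show (-0.1 : ℝ) < 0 by norm_num)).Dtmin -
                      2 * A) *
                    (bandBounds (show (-4 : ℝ) < -1.1 by norm_num) (show (-1.1 : ℝ) ≤ -0.1 by norm_num) (show (-0.1 : ℝ) < 0 by norm_num)).umin) +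
                π * Kc * c₀ / ((bandBounds (show (-4 : ℝ) < -1.1 by norm_num) (show (-1.1 : ℝ) ≤ -0.1 by norm_num) (show (-0.1 : ℝ) < 0 by norm_num)).Dtmin - 2 * A) ^ 2) /
              ((bandBounds (show (-4 : ℝ) < -1.1 by norm_num) (show (-1.1 : ℝ) ≤ -0.1 by norm_num) (show (-0.1 : ℝ) < 0 by norm_num)).umin * w /
                (4 + 2 * A)))) +
          c₀ / ((bandBounds (show (-4 : ℝ) < -1.1 by norm_num) (show (-1.1 : ℝ) ≤ -0.1 by norm_num) (show (-0.1 : ℝ) < 0 by norm_num)).Dtmin - 2 * A)) +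
          2 * hi / ((bandBounds (show (-4 : ℝ) < -1.1 by norm_num) (show (-1.1 : ℝ) ≤ -0.1 by norm_num) (show (-0.1 : ℝ) < 0 by norm_num)).Dtmin - 2 * A) + sC <
        2 * (bandBounds (show (-4 : ℝ) < -1.1 by norm_num) (show (-1.1 : ℝ) ≤ -0.1 by norm_num) (show (-0.1 : ℝ) < 0 by norm_num)).umin)
    (hhirC : hi + c₀ * sC < r) (hNC : (b - a) * (4 * (K₂ * msD A₃ A₄ 1)) ≤ NC * c₀)
    (hd₁ : 0 < d₁) (hκ : 0 < κ)
    (hs₀ : ((msD A₃ A₄ 1 *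
            ((π / 2 * d₁ /
                  (((bandBounds (show (-4 : ℝ) < -1.1 by norm_num) (show (-1.1 : ℝ) ≤ -0.1 by norm_num) (show (-0.1 : ℝ) < 0 by norm_num)).Dtmin -
                      2 * A) *
                    (bandBounds (show (-4 : ℝ) < -1.1 by norm_num) (show (-1.1 : ℝ) ≤ -0.1 by norm_num) (show (-0.1 : ℝ) < 0 by norm_num)).umin) +
                π * Kc * κ / ((bandBounds (show (-4 : ℝ) < -1.1 by norm_num) (show (-1.1 : ℝ) ≤ -0.1 by norm_num) (show (-0.1 : ℝ) < 0 by norm_num)).Dtmin - 2 * A) ^ 2) /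
              ((bandBounds (show (-4 : ℝ) < -1.1 by norm_num) (show (-1.1 : ℝ) ≤ -0.1 by norm_num) (show (-0.1 : ℝ) < 0 by norm_num)).umin * w /
                (4 + 2 * A)))) +
          κ / ((bandBounds (show (-4 : ℝ) < -1.1 by norm_num) (show (-1.1 : ℝ) ≤ -0.1 by norm_num) (show (-0.1 : ℝ) < 0 by norm_num)).Dtmin - 2 * A)) ≤ sC)
    (hs₀' : ((msD A₃ A₄ 1 *
            ((π / 2 * d₁ /
                  (((bandBounds (show (-4 : ℝ) < -1.1 by norm_num) (show (-1.1 : ℝ) ≤ -0.1 by norm_num) (show (-0.1 : ℝ) < 0 by norm_num)).Dtmin -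
                      2 * A) *
                    (bandBounds (show (-4 : ℝ) < -1.1 by norm_num) (show (-1.1 : ℝ) ≤ -0.1 by norm_num) (show (-0.1 : ℝ) < 0 by norm_num)).umin) +
                π * Kc * κ / ((bandBounds (show (-4 : ℝ) < -1.1 by norm_num) (show (-1.1 : ℝ) ≤ -0.1 by norm_num) (show (-0.1 : ℝ) < 0 by norm_num)).Dtmin - 2 * A) ^ 2) /
              ((bandBounds (show (-4 : ℝ) < -1.1 by norm_num) (show (-1.1 : ℝ) ≤ -0.1 by norm_num) (show (-0.1 : ℝ) < 0 by norm_num)).umin * w /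
                (4 + 2 * A)))) +
          κ / ((bandBounds (show (-4 : ℝ) < -1.1 by norm_num) (show (-1.1 : ℝ) ≤ -0.1 by norm_num) (show (-0.1 : ℝ) < 0 by norm_num)).Dtmin - 2 * A)) ≤ 3 / 5)
    (hhirT : hi + κ < r)
    (hsmall :
        K₃ * ((msD A₃ A₄ 1 *
            ((π / 2 * d₁ /
                  (((bandBounds (show (-4 : ℝ) < -1.1 by norm_num) (show (-1.1 : ℝ) ≤ -0.1 by norm_num) (show (-0.1 : ℝ) < 0 by norm_num)).Dtmin -
                      2 * A) *
                    (bandBounds (show (-4 : ℝ) < -1.1 by norm_num) (show (-1.1 : ℝ) ≤ -0.1 by norm_num) (show (-0.1 : ℝ) < 0 by norm_num)).umin) +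
                π * Kc * κ / ((bandBounds (show (-4 : ℝ) < -1.1 by norm_num) (show (-1.1 : ℝ) ≤ -0.1 by norm_num) (show (-0.1 : ℝ) < 0 by norm_num)).Dtmin - 2 * A) ^ 2) /
              ((bandBounds (show (-4 : ℝ) < -1.1 by norm_num) (show (-1.1 : ℝ) ≤ -0.1 by norm_num) (show (-0.1 : ℝ) < 0 by norm_num)).umin * w /
                (4 + 2 * A)))) +
          (2 * hi + κ) / ((bandBounds (show (-4 : ℝ) < -1.1 by norm_num) (show (-1.1 : ℝ) ≤ -0.1 by norm_num) (show (-0.1 : ℝ) < 0 by norm_num)).Dtmin - 2 * A) +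
              hi / ((bandBounds (show (-4 : ℝ) < -1.1 by norm_num) (show (-1.1 : ℝ) ≤ -0.1 by norm_num) (show (-0.1 : ℝ) < 0 by norm_num)).Dtmin - 2 * A)) *
            msD A₃ A₄ 1 ^ 2 +
          K₂ * (radialRowOneConst A ((bandBounds (show (-4 : ℝ) < -1.1 by norm_num) (show (-1.1 : ℝ) ≤ -0.1 by norm_num) (show (-0.1 : ℝ) < 0 by norm_num)).Dtmin -
                2 * A) * hi) * (msD A₃ A₄ 1 + msD A₃ A₄ 1) +
          K₂ * ((msD A₃ A₄ 1 *
            ((π / 2 * d₁ /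
                  (((bandBounds (show (-4 : ℝ) < -1.1 by norm_num) (show (-1.1 : ℝ) ≤ -0.1 by norm_num) (show (-0.1 : ℝ) < 0 by norm_num)).Dtmin -
                      2 * A) *
                    (bandBounds (show (-4 : ℝ) < -1.1 by norm_num) (show (-1.1 : ℝ) ≤ -0.1 by norm_num) (show (-0.1 : ℝ) < 0 by norm_num)).umin) +
                π * Kc * κ / ((bandBounds (show (-4 : ℝ) < -1.1 by norm_num) (show (-1.1 : ℝ) ≤ -0.1 by norm_num) (show (-0.1 : ℝ) < 0 by norm_num)).Dtmin - 2 * A) ^ 2) /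
              ((bandBounds (show (-4 : ℝ) < -1.1 by norm_num) (show (-1.1 : ℝ) ≤ -0.1 by norm_num) (show (-0.1 : ℝ) < 0 by norm_num)).umin * w /
                (4 + 2 * A)))) +
          (2 * hi + κ) / ((bandBounds (show (-4 : ℝ) < -1.1 by norm_num) (show (-1.1 : ℝ) ≤ -0.1 by norm_num) (show (-0.1 : ℝ) < 0 by norm_num)).Dtmin - 2 * A) +
              hi / ((bandBounds (show (-4 : ℝ) < -1.1 by norm_num) (show (-1.1 : ℝ) ≤ -0.1 by norm_num) (show (-0.1 : ℝ) < 0 by norm_num)).Dtmin - 2 * A)) *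
            msD A₃ A₄ 2 +
          K₁ * ((uRowTwoConst A A₃ ((bandBounds (show (-4 : ℝ) < -1.1 by norm_num) (show (-1.1 : ℝ) ≤ -0.1 by norm_num) (show (-0.1 : ℝ) < 0 by norm_num)).Dtmin -
                  2 * A) +
                1 / ((bandBounds (show (-4 : ℝ) < -1.1 by norm_num) (show (-1.1 : ℝ) ≤ -0.1 by norm_num) (show (-0.1 : ℝ) < 0 by norm_num)).Dtmin - 2 * A) +
                2 * (radialRowOneConst A ((bandBounds (show (-4 : ℝ) < -1.1 by norm_num) (show (-1.1 : ℝ) ≤ -0.1 by norm_num) (show (-0.1 : ℝ) < 0 by norm_num)).Dtmin - 2 * A) -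
                  1 / ((bandBounds (show (-4 : ℝ) < -1.1 by norm_num) (show (-1.1 : ℝ) ≤ -0.1 by norm_num) (show (-0.1 : ℝ) < 0 by norm_num)).Dtmin - 2 * A))) *
              hi) ≤
        w * (bandBounds (show (-4 : ℝ) < -1.1 by norm_num) (show (-1.1 : ℝ) ≤ -0.1 by norm_num) (show (-0.1 : ℝ) < 0 by norm_num)).umin ^ 2)
    (hNT : (b - a) * (4 * (K₁ * msD A₃ A₄ 1)) ≤ NT * κ) (hNT' : (b - a) * (4 * (K₂ * msD A₃ A₄ 1 ^ 2 + K₁ * msD A₃ A₄ 2)) ≤ NT * d₁)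
    (ht : ∀ e ∈ Icc lo hi, e ≤ t e) (hW : 0 ≤ W) (hw0 : ∀ e ∈ Icc lo hi, 0 ≤ wt e) (hw : ∀ e ∈ Icc lo hi, wt e ≤ W) :
    ∫ ϑ in (0 - π)..(0 + π), (∫ e in lo..hi, wt e * ∫ x in Icc a b, (max (t e) |frameLevel μ K (levelPoint μ K e (x + θ) - pairDiffPath μ K ρ ϑ θ 0)|)⁻¹) ≤
      2 * π * ((W * ((4 * (b - a) / κ + 2 * (NT * (4 / d₁))) * (κ / 2) +
          2 * (12 * NT / Real.sqrt (w * (bandBounds (show (-4 : ℝ) < -1.1 by norm_num) (show (-1.1 : ℝ) ≤ -0.1 by norm_num) (show (-0.1 : ℝ) < 0 by norm_num)).umin ^ 2)) * Real.sqrt (κ / 2) + (b - a) * log⁺ (hi / (κ / 2)))) + (W * (2 * (b - a) + 2 * (NC * c₀ / c₁))) +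
        (W * (b - a)) * (1 + log⁺ ((π * hi / (c₀ * (bandBounds (show (-4 : ℝ) < -1.1 by norm_num) (show (-1.1 : ℝ) ≤ -0.1 by norm_num) (show (-0.1 : ℝ) < 0 by norm_num)).umin)) / π))) := by
  simp only [partnerBand_ph_eq_pp_sub_pi]
  have h := intervalIntegral_angle_absBubble_partnerBand_le_window hA hA20 hd hr hlo hhi hA₃ hA₄ hK₁ hK₂ hK₃ hG hK₁0 hK₂0 (0 - π) (θ := θ) (t := t) (wt := wt)
    hρ hab hlo0 hlohi hhir₀ hc₀ hc₁ hX hwinC hwinC' hhirC hNC hd₁ hκ hs₀ hs₀' hhirT hsmall hNT hNT' ht hW hw0 hw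
  rw [intervalIntegral.integral_comp_sub_right (fun ϑ => ∫ e in lo..hi, wt e * ∫ x in Icc a b,
      (max (t e) |frameLevel μ K (pairSumPath μ K ρ ϑ θ 0 - levelPoint μ K e (x + θ))|)⁻¹) π]
  rw [show 0 - π - π = (0 - π) - π by ring, show 0 + π - π = (0 - π) + π by ring]
  exact h

end Sizes

end Summit.HubbardSuperconductivity.HubbardSuperconductivity.Theorems.C4a

end
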